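import Mathlib
import HarnessLib.Audit
import Summits.PneNP.PneNP.Theorems.PstarGConstraint
import Summits.PneNP.PneNP.Theorems.PstarXorElimination
import Summits.PneNP.PneNP.Theorems.PstarXCore
import Summits.PneNP.PneNP.Theorems.PstarChordRepair
import Summits.PneNP.PneNP.Theorems.PstarCentreFree

/-!
# Tools for the instance-to-chord-system bridge (ROUND-24, memo §9 R1 / §11; GAPTWO-PLAN S4)

FRONTIER range-avoidance ladder, rung F-N3, ROUND 24 (cell `pnp-ideate`, planner memo `r24/CORE-BOUND-NOTES.md` §1–2, §10–11;
restricted-model proof complexity — nothing here bears on `P` versus `NP`).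

Mechanism-free bookkeeping behind `PstarChordBridge` (the R1 step of the `CoreShape` chain: a terminal core with a set of chords IS a
`PstarChordSystem.ChordSystem` on the cube `Fin n → 𝔽₂`).  Everything is PATH-FREE: fundamental paths and joins enter only through the
PARITY of slot-incidence degrees (`PstarXorElimination.pdeg`).

* `sum_pair_eq_sum_pdeg`, `sum_pair_eq_zero_of_even`, `sum_pair_eq_sum_filter_odd` — `Σ_{j∈E} (x u_j + x v_j) = Σ_w pdeg_E(w)·x_w`;
* `privs` (the private AND variables of a set `N` of chords of `J₀`), `chord_eq_of_vars_eq` (a private is owned by one chord and one slot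
  class), `sum_privs` (sums over privates are sums over chords), `not_mem_privs_of_mem_sdiff`, `not_mem_xverts_of_two_le`;
* `setPriv` — overwrite the privates by prescribed states; `setPriv_two / setPriv_three / setPriv_of_not_mem`;
* `uval`, `coef`, `free` — the prescribed product `γ_e + Q_{D_e}`, the read coefficient of a private in a G-constraint, and the state-free
  part of a G-constraint (memo §10 "coordinates on V₀");
* `bit_eval_chord` — on a solution of the non-chord equations, chord `e` holds iff `a_{p_e} a_{p'_e} = uval` (the cycle equation of
  `D_e + e`, from the evenness of `D_e + e` alone);
* `bit_gval_eq` — on a solution of the non-chord equations, a G-constraint with a join `T` of its XOR reads and no CROSS pendant decomposes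
  as `free + Σ_{e∈N} (a_{p_e}·coef(p_e) + a_{p'_e}·coef(p'_e))`.
-/

set_option linter.dupNamespace false -- `Summit.PneNP.PneNP.…`: summit = sub-problem name (D-0017 single-conjunct layout)

open Finset Literature.Computability.Complexity
open Summit.PneNP.PneNP.Theorems.PstarFibrePolys (bit bit_xor bit_and bit_injective)
open Summit.PneNP.PneNP.Theorems.PstarPDT (parity bit_eval)
open Summit.PneNP.PneNP.Theorems.PstarTyped (Typed)
open Summit.PneNP.PneNP.Theorems.PstarSALevel (varSet bdry)
open Summit.PneNP.PneNP.Theorems.PstarGapOneAll (gval)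
open Summit.PneNP.PneNP.Theorems.PstarGConstraint (bit_gval)
open Summit.PneNP.PneNP.Theorems.PstarXorElimination (pdeg)
open Summit.PneNP.PneNP.Theorems.PstarXCore (xpair xverts mem_xpair)
open Summit.PneNP.PneNP.Theorems.PstarChordRepair (IsChord)
open Summit.PneNP.PneNP.Theorems.PstarGapPeeling (not_mem_varSet_of_private eval_congr)
open Summit.PneNP.PneNP.Theorems.PstarCentreFree (vars_mem_varSet)

namespace Summit.PneNP.PneNP.Theorems.PstarChordBridgeTools

variable {n m : ℕ}

/-! ## Pair sums and slot-incidence degrees -/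

/-- **`Σ_{j∈E} (x u_j + x v_j) = Σ_w pdeg_E(w) · x_w`.** -/
theorem sum_pair_eq_sum_pdeg (u v : Fin m → Fin n) (E : Finset (Fin m)) (x : Fin n → ZMod 2) :
    ∑ j ∈ E, (x (u j) + x (v j)) = ∑ w, (pdeg u v E w : ZMod 2) * x w := by
  classical
  induction E using Finset.induction_on with
  | empty => simp [pdeg]
  | insert j E hj ih =>
    rw [sum_insert hj, ih]
    have hp : ∀ w, (pdeg u v (insert j E) w : ZMod 2) * x w =
        (pdeg u v E w : ZMod 2) * x w + ((if u j = w then x w else 0) + (if v j = w then x w else 0)) := by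
      intro w
      unfold pdeg
      rw [filter_insert, filter_insert]
      by_cases h1 : u j = w <;> by_cases h2 : v j = w <;>
        simp only [h1, h2, if_true, if_false, card_insert_of_notMem (fun h => hj (mem_filter.1 h).1), Nat.cast_add,
          Nat.cast_one] <;> ring
    rw [sum_congr rfl fun w _ => hp w, sum_add_distrib, sum_add_distrib, sum_ite_eq, sum_ite_eq]
    simp only [mem_univ, if_true]
    ring

/-- An everywhere-even edge set has vanishing pair sum. -/
theorem sum_pair_eq_zero_of_even {u v : Fin m → Fin n} {E : Finset (Fin m)} (h : ∀ w, Even (pdeg u v E w))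
    (x : Fin n → ZMod 2) : ∑ j ∈ E, (x (u j) + x (v j)) = 0 := by
  rw [sum_pair_eq_sum_pdeg]
  refine sum_eq_zero fun w _ => ?_
  rw [(ZMod.natCast_eq_zero_iff_even).2 (h w), zero_mul]

/-- The pair sum is the sum over the odd-degree vertices. -/
theorem sum_pair_eq_sum_filter_odd (u v : Fin m → Fin n) (E : Finset (Fin m)) (x : Fin n → ZMod 2) :
    ∑ j ∈ E, (x (u j) + x (v j)) = ∑ w ∈ univ.filter (fun w => Odd (pdeg u v E w)), x w := by
  classical
  rw [sum_pair_eq_sum_pdeg, sum_filter]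
  refine sum_congr rfl fun w _ => ?_
  by_cases h : Odd (pdeg u v E w)
  · rw [(ZMod.natCast_eq_one_iff_odd).2 h, one_mul, if_pos h]
  · rw [(ZMod.natCast_eq_zero_iff_even).2 (Nat.not_odd_iff_even.1 h), zero_mul, if_neg h]

/-- Removing one edge from an everywhere-even set: the pair of the removed edge equals the pair sum of the rest. -/
theorem pair_eq_sum_of_even_insert {u v : Fin m → Fin n} {D : Finset (Fin m)} {e : Fin m} (he : e ∉ D)
    (h : ∀ w, Even (pdeg u v (insert e D) w)) (x : Fin n → ZMod 2) :
    x (u e) + x (v e) = ∑ j ∈ D, (x (u j) + x (v j)) := by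
  have h0 := sum_pair_eq_zero_of_even h x
  rw [sum_insert he] at h0
  have e2 : ∀ a b : ZMod 2, a + b = 0 → a = b := by decide
  exact e2 _ _ h0

/-! ## Private AND variables of a chord set -/

/-- Slot-incidence degree in the XOR multigraph of a set of outputs (slots `0, 1`). -/
abbrev xpdeg (I : LocalMap 4 n m) (E : Finset (Fin m)) (w : Fin n) : ℕ := pdeg (fun j => I.vars j 0) (fun j => I.vars j 1) E w

/-- The PRIVATES of the chord set `N`: both AND variables of every member. -/
def privs (I : LocalMap 4 n m) (N : Finset (Fin m)) : Finset (Fin n) := N.biUnion fun e => {I.vars e 2, I.vars e 3}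

/-- Membership in the privates. -/
theorem mem_privs (I : LocalMap 4 n m) {N : Finset (Fin m)} {v : Fin n} :
    v ∈ privs I N ↔ ∃ e ∈ N, I.vars e 2 = v ∨ I.vars e 3 = v := by
  unfold privs
  simp only [mem_biUnion, mem_insert, mem_singleton]
  constructor
  · rintro ⟨e, he, h | h⟩
    · exact ⟨e, he, Or.inl h.symm⟩
    · exact ⟨e, he, Or.inr h.symm⟩
  · rintro ⟨e, he, h | h⟩
    · exact ⟨e, he, Or.inl h.symm⟩
    · exact ⟨e, he, Or.inr h.symm⟩

/-- The AND variables of a chord are privates. -/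
theorem vars_mem_privs (I : LocalMap 4 n m) {N : Finset (Fin m)} {e : Fin m} (he : e ∈ N) {s : Fin 4} (hs : 2 ≤ s.val) :
    I.vars e s ∈ privs I N := by
  rw [mem_privs]
  have : s = 2 ∨ s = 3 := by
    rcases s with ⟨s, hs4⟩
    simp only [Fin.ext_iff] at *
    omega
  rcases this with rfl | rfl
  · exact ⟨e, he, Or.inl rfl⟩
  · exact ⟨e, he, Or.inr rfl⟩

/-- **A private is owned by one chord**: if an AND slot of a chord `e ∈ N` and any slot of an output `j ∈ J₀` hold the same variable then
`j = e`. -/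
theorem chord_eq_of_vars_eq (I : LocalMap 4 n m) {J₀ N : Finset (Fin m)} (hN : N ⊆ J₀) (hch : ∀ e ∈ N, IsChord I J₀ e)
    {e j : Fin m} (he : e ∈ N) (hj : j ∈ J₀) {s s' : Fin 4} (hs : 2 ≤ s.val) (h : I.vars e s = I.vars j s') : j = e := by
  by_contra hne
  have hb : I.vars e s ∈ bdry I J₀ := by
    have : s = 2 ∨ s = 3 := by
      rcases s with ⟨s, hs4⟩
      simp only [Fin.ext_iff] at *
      omega
    rcases this with rfl | rfl
    · exact (hch e he).1
    · exact (hch e he).2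
  exact not_mem_varSet_of_private I (hN he) hj hne hb (vars_mem_varSet I e s) (h ▸ vars_mem_varSet I j s')

/-- A non-chord output of `J₀` reads no private. -/
theorem not_mem_privs_of_mem_sdiff (I : LocalMap 4 n m) {J₀ N : Finset (Fin m)} (hN : N ⊆ J₀) (hch : ∀ e ∈ N, IsChord I J₀ e)
    {j : Fin m} (hj : j ∈ J₀ \ N) (s : Fin 4) : I.vars j s ∉ privs I N := by
  rw [mem_privs]
  rintro ⟨e, he, h | h⟩
  · have := chord_eq_of_vars_eq I hN hch he (mem_sdiff.1 hj).1 (s := 2) (by decide) h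
    exact (mem_sdiff.1 hj).2 (this ▸ he)
  · have := chord_eq_of_vars_eq I hN hch he (mem_sdiff.1 hj).1 (s := 3) (by decide) h
    exact (mem_sdiff.1 hj).2 (this ▸ he)

/-- On a typed instance an AND-slot variable is no XOR vertex. -/
theorem not_mem_xverts_of_two_le (I : LocalMap 4 n m) (hT : Typed I) (E : Finset (Fin m)) (j : Fin m) {s : Fin 4} (hs : 2 ≤ s.val) :
    I.vars j s ∉ xverts I E := by
  unfold PstarXCore.xverts
  rw [mem_biUnion]
  rintro ⟨j', -, h⟩
  rcases (mem_xpair I).1 h with h | h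
  · exact hT j' j 0 s (by decide) hs h.symm
  · exact hT j' j 1 s (by decide) hs h.symm

/-- On a typed instance privates are no XOR vertices. -/
theorem not_mem_xverts_of_mem_privs (I : LocalMap 4 n m) (hT : Typed I) {N : Finset (Fin m)} (E : Finset (Fin m)) {v : Fin n}
    (hv : v ∈ privs I N) : v ∉ xverts I E := by
  obtain ⟨e, -, h | h⟩ := (mem_privs I).1 hv
  · exact h ▸ not_mem_xverts_of_two_le I hT E e (s := 2) (by decide)
  · exact h ▸ not_mem_xverts_of_two_le I hT E e (s := 3) (by decide)

/-- **Sums over privates are sums over chords.** -/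
theorem sum_privs (I : LocalMap 4 n m) (hI : I.IsPure xorAndPred) {J₀ N : Finset (Fin m)} (hN : N ⊆ J₀)
    (hch : ∀ e ∈ N, IsChord I J₀ e) (f : Fin n → ZMod 2) :
    ∑ v ∈ privs I N, f v = ∑ e ∈ N, (f (I.vars e 2) + f (I.vars e 3)) := by
  classical
  unfold privs
  rw [sum_biUnion]
  · exact sum_congr rfl fun e _ => sum_pair fun h => absurd (hI.2 e h) (by decide)
  · intro e he e' he' hne
    simp only [Function.onFun]
    rw [disjoint_left]
    intro v hv hv'
    simp only [mem_insert, mem_singleton] at hv hv'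
    rcases hv with rfl | rfl
    · rcases hv' with h | h
      · exact hne (chord_eq_of_vars_eq I hN hch he' (hN he) (s := 2) (by decide) h.symm)
      · exact hne (chord_eq_of_vars_eq I hN hch he' (hN he) (s := 3) (by decide) h.symm)
    · rcases hv' with h | h
      · exact hne (chord_eq_of_vars_eq I hN hch he' (hN he) (s := 2) (by decide) h.symm)
      · exact hne (chord_eq_of_vars_eq I hN hch he' (hN he) (s := 3) (by decide) h.symm)

/-! ## Overwriting the privates by states -/

/-- Overwrite the privates of the chords of `N` by the Boolean states `s e = (a_{p_e}, a_{p'_e})`. -/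
noncomputable def setPriv (I : LocalMap 4 n m) (N : Finset (Fin m)) (s : Fin m → Bool × Bool) (z : Fin n → Bool) : Fin n → Bool :=
  fun v => if h : ∃ e ∈ N, I.vars e 2 = v then (s h.choose).1
    else if h' : ∃ e ∈ N, I.vars e 3 = v then (s h'.choose).2 else z v

/-- Outside the privates nothing changes. -/
theorem setPriv_of_not_mem (I : LocalMap 4 n m) {N : Finset (Fin m)} (s : Fin m → Bool × Bool) (z : Fin n → Bool) {v : Fin n}
    (hv : v ∉ privs I N) : setPriv I N s z v = z v := by
  unfold setPriv
  rw [mem_privs] at hv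
  have h1 : ¬ ∃ e ∈ N, I.vars e 2 = v := fun ⟨e, he, h⟩ => hv ⟨e, he, Or.inl h⟩
  have h2 : ¬ ∃ e ∈ N, I.vars e 3 = v := fun ⟨e, he, h⟩ => hv ⟨e, he, Or.inr h⟩
  rw [dif_neg h1, dif_neg h2]

/-- The first AND slot of a chord receives the first state bit. -/
theorem setPriv_two (I : LocalMap 4 n m) {J₀ N : Finset (Fin m)} (hN : N ⊆ J₀) (hch : ∀ e ∈ N, IsChord I J₀ e)
    (s : Fin m → Bool × Bool) (z : Fin n → Bool) {e : Fin m} (he : e ∈ N) : setPriv I N s z (I.vars e 2) = (s e).1 := by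
  unfold setPriv
  have h : ∃ e' ∈ N, I.vars e' 2 = I.vars e 2 := ⟨e, he, rfl⟩
  rw [dif_pos h]
  have := chord_eq_of_vars_eq I hN hch h.choose_spec.1 (hN he) (s := 2) (s' := 2) (by decide) h.choose_spec.2
  rw [← this]

/-- The second AND slot of a chord receives the second state bit. -/
theorem setPriv_three (I : LocalMap 4 n m) (hI : I.IsPure xorAndPred) {J₀ N : Finset (Fin m)} (hN : N ⊆ J₀)
    (hch : ∀ e ∈ N, IsChord I J₀ e) (s : Fin m → Bool × Bool) (z : Fin n → Bool) {e : Fin m} (he : e ∈ N) :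
    setPriv I N s z (I.vars e 3) = (s e).2 := by
  unfold setPriv
  have h1 : ¬ ∃ e' ∈ N, I.vars e' 2 = I.vars e 3 := by
    rintro ⟨e', he', h⟩
    have := chord_eq_of_vars_eq I hN hch he' (hN he) (s := 2) (s' := 3) (by decide) h
    subst this
    exact absurd (hI.2 _ h) (by decide)
  have h : ∃ e' ∈ N, I.vars e' 3 = I.vars e 3 := ⟨e, he, rfl⟩
  rw [dif_neg h1, dif_pos h]
  have := chord_eq_of_vars_eq I hN hch h.choose_spec.1 (hN he) (s := 3) (s' := 3) (by decide) h.choose_spec.2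
  rw [← this]

/-- Overwriting privates does not disturb the non-chord outputs of `J₀`. -/
theorem eval_setPriv_of_mem_sdiff (I : LocalMap 4 n m) {J₀ N : Finset (Fin m)} (hN : N ⊆ J₀) (hch : ∀ e ∈ N, IsChord I J₀ e)
    (s : Fin m → Bool × Bool) (z : Fin n → Bool) {j : Fin m} (hj : j ∈ J₀ \ N) : I.eval (setPriv I N s z) j = I.eval z j :=
  eval_congr I j fun t => setPriv_of_not_mem I s z (not_mem_privs_of_mem_sdiff I hN hch hj t)

/-! ## The three functions of the bridge -/

/-- The PRESCRIBED PRODUCT of chord `e` with fundamental path `D`: `γ_e + Q_D(x) = y_e + Σ_{j∈D} (y_j + x_{p_j} x_{q_j})`. -/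
def uval (I : LocalMap 4 n m) (y : Fin m → Bool) (D : Finset (Fin m)) (e : Fin m) (x : Fin n → ZMod 2) : ZMod 2 :=
  bit (y e) + ∑ j ∈ D, (bit (y j) + x (I.vars j 2) * x (I.vars j 3))

/-- The READ COEFFICIENT of the AND variable `p` in the G-constraint `(C, G)`: `[p ∈ C] + Σ_{g∈G : p ∈ g} x_{partner}`. -/
def coef (I : LocalMap 4 n m) (C : Finset (Fin n)) (G : Finset (Fin m)) (p : Fin n) (x : Fin n → ZMod 2) : ZMod 2 :=
  (if p ∈ C then 1 else 0) + ∑ g ∈ G, ((if I.vars g 2 = p then x (I.vars g 3) else 0) + (if I.vars g 3 = p then x (I.vars g 2) else 0))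

/-- The STATE-FREE PART of the G-constraint `(C, G)` relative to the non-chord outputs `F`, the chords `N` and the join `T ⊆ F` of the XOR
reads: linear reads that are neither XOR vertices of `F` nor privates, the join's sum `Σ_{j∈T} (y_j + x_{p_j} x_{q_j})`, and the monomials
of `G` containing no private. -/
def free (I : LocalMap 4 n m) (y : Fin m → Bool) (F N T : Finset (Fin m)) (C : Finset (Fin n)) (G : Finset (Fin m))
    (x : Fin n → ZMod 2) : ZMod 2 :=
  ∑ v ∈ C.filter (fun v => v ∉ xverts I F ∧ v ∉ privs I N), x v
    + ∑ j ∈ T, (bit (y j) + x (I.vars j 2) * x (I.vars j 3))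
    + ∑ g ∈ G.filter (fun g => ¬ (I.vars g 2 ∈ privs I N ∨ I.vars g 3 ∈ privs I N)), x (I.vars g 2) * x (I.vars g 3)

/-- A satisfied pure output in `𝔽₂`: `x_u + x_v = y_j + x_p x_q`. -/
theorem pair_eq_of_eval (I : LocalMap 4 n m) (hI : I.IsPure xorAndPred) {y : Fin m → Bool} {z : Fin n → Bool} {j : Fin m}
    (h : I.eval z j = y j) :
    bit (z (I.vars j 0)) + bit (z (I.vars j 1)) = bit (y j) + bit (z (I.vars j 2)) * bit (z (I.vars j 3)) := by
  have e := bit_eval hI z j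
  rw [h] at e
  have key : ∀ a b c d : ZMod 2, d = a + b + c → a + b = d + c := by decide
  exact key _ _ _ _ e

/-- **The cycle equation of a chord.**  If `z` satisfies the non-chord outputs `J₀ ∖ N`, `D ⊆ J₀ ∖ N`, `e ∉ D` and `D + e` is everywhere
even, then `I(z)_e + y_e = uval_D(e) + z_{p_e} z_{q_e}` in `𝔽₂`; so output `e` holds at `z` iff `z_{p_e} z_{q_e} = uval`. -/
theorem bit_eval_chord (I : LocalMap 4 n m) (hI : I.IsPure xorAndPred) (y : Fin m → Bool) {J₀ N D : Finset (Fin m)}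
    (hD : D ⊆ J₀ \ N) {e : Fin m} (heD : e ∉ D) (heven : ∀ w, Even (xpdeg I (insert e D) w)) {z : Fin n → Bool}
    (hz : ∀ j ∈ J₀ \ N, I.eval z j = y j) :
    bit (I.eval z e) + bit (y e) = uval I y D e (fun v => bit (z v)) + bit (z (I.vars e 2)) * bit (z (I.vars e 3)) := by
  have hpair := pair_eq_sum_of_even_insert (u := fun j => I.vars j 0) (v := fun j => I.vars j 1) heD heven (fun v => bit (z v))
  have hsum : ∑ j ∈ D, (bit (z (I.vars j 0)) + bit (z (I.vars j 1))) =
      ∑ j ∈ D, (bit (y j) + bit (z (I.vars j 2)) * bit (z (I.vars j 3))) :=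
    sum_congr rfl fun j hj => pair_eq_of_eval I hI (hz j (hD hj))
  rw [bit_eval hI z e, hpair, hsum]
  unfold uval
  ring

/-- Boolean form of the cycle equation: output `e` holds iff the product of its AND variables is the prescribed product. -/
theorem eval_eq_iff_chord (I : LocalMap 4 n m) (hI : I.IsPure xorAndPred) (y : Fin m → Bool) {J₀ N D : Finset (Fin m)}
    (hD : D ⊆ J₀ \ N) {e : Fin m} (heD : e ∉ D) (heven : ∀ w, Even (xpdeg I (insert e D) w)) {z : Fin n → Bool}
    (hz : ∀ j ∈ J₀ \ N, I.eval z j = y j) :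
    I.eval z e = y e ↔ bit (z (I.vars e 2)) * bit (z (I.vars e 3)) = uval I y D e (fun v => bit (z v)) := by
  have h := bit_eval_chord I hI y hD heD heven hz
  constructor
  · intro he
    rw [he] at h
    have key : ∀ a u p : ZMod 2, a + a = u + p → p = u := by decide
    exact key _ _ _ h
  · intro hp
    apply bit_injective
    have key : ∀ a b u p : ZMod 2, a + b = u + p → p = u → a = b := by decide
    exact key _ _ _ _ h hp

/-! ## Decomposition of a G-constraint -/

/-- **The G-constraint splits into its state-free part and the private reads.**  Hypotheses: `z` satisfies the non-chord outputs
`F = J₀ ∖ N`; `T ⊆ F` is a JOIN of the XOR reads (a vertex has odd slot-degree in `T` iff it is an XOR vertex of `F` lying in `C`); no monomial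
of `G` has both variables private (no CROSS pendant).  Then
`gval(C,G)(z) = free(x) + Σ_{e∈N} (x_{p_e}·coef(p_e)(x) + x_{q_e}·coef(q_e)(x))` with `x = bit ∘ z`. -/
theorem bit_gval_eq (I : LocalMap 4 n m) (hI : I.IsPure xorAndPred) (hT : Typed I) {J₀ N : Finset (Fin m)} (hN : N ⊆ J₀)
    (hch : ∀ e ∈ N, IsChord I J₀ e) (y : Fin m → Bool) {T : Finset (Fin m)} (hTF : T ⊆ J₀ \ N) (C : Finset (Fin n))
    (G : Finset (Fin m)) (hjoin : ∀ w, Odd (xpdeg I T w) ↔ w ∈ C ∧ w ∈ xverts I (J₀ \ N))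
    (hcross : ∀ g ∈ G, ¬ (I.vars g 2 ∈ privs I N ∧ I.vars g 3 ∈ privs I N)) {z : Fin n → Bool}
    (hz : ∀ j ∈ J₀ \ N, I.eval z j = y j) :
    bit (gval I C G z) = free I y (J₀ \ N) N T C G (fun v => bit (z v))
      + ∑ e ∈ N, (bit (z (I.vars e 2)) * coef I C G (I.vars e 2) (fun v => bit (z v))
          + bit (z (I.vars e 3)) * coef I C G (I.vars e 3) (fun v => bit (z v))) := by
  classical
  set x : Fin n → ZMod 2 := fun v => bit (z v) with hx
  -- the linear part, split three ways
  have hC : ∑ v ∈ C, x v = ∑ j ∈ T, (bit (y j) + x (I.vars j 2) * x (I.vars j 3))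
      + ∑ v ∈ C.filter (fun v => v ∉ xverts I (J₀ \ N) ∧ v ∉ privs I N), x v
      + ∑ v ∈ privs I N, (if v ∈ C then x v else 0) := by
    rw [← sum_filter_add_sum_filter_not C (fun v => v ∈ xverts I (J₀ \ N))]
    have h1 : ∑ v ∈ C.filter (fun v => v ∈ xverts I (J₀ \ N)), x v = ∑ j ∈ T, (bit (y j) + x (I.vars j 2) * x (I.vars j 3)) := by
      have hset : C.filter (fun v => v ∈ xverts I (J₀ \ N)) = univ.filter (fun w => Odd (xpdeg I T w)) := by
        ext w
        simp only [mem_filter, mem_univ, true_and, hjoin]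
      rw [hset, ← sum_pair_eq_sum_filter_odd]
      exact sum_congr rfl fun j hj => pair_eq_of_eval I hI (hz j (hTF hj))
    have h2 : ∑ v ∈ C.filter (fun v => ¬ v ∈ xverts I (J₀ \ N)), x v =
        ∑ v ∈ C.filter (fun v => v ∉ xverts I (J₀ \ N) ∧ v ∉ privs I N), x v + ∑ v ∈ privs I N, (if v ∈ C then x v else 0) := by
      rw [← sum_filter_add_sum_filter_not (C.filter (fun v => ¬ v ∈ xverts I (J₀ \ N))) (fun v => v ∉ privs I N),
        filter_filter, filter_filter]
      congr 1
      rw [← sum_filter]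
      apply sum_congr _ (fun _ _ => rfl)
      ext v
      simp only [mem_filter, not_not]
      constructor
      · rintro ⟨hvC, -, hvp⟩; exact ⟨hvp, hvC⟩
      · rintro ⟨hvp, hvC⟩; exact ⟨hvC, not_mem_xverts_of_mem_privs I hT _ hvp, hvp⟩
    rw [h1, h2, add_assoc]
  -- the monomial part, split two ways
  have hG : ∑ g ∈ G, x (I.vars g 2) * x (I.vars g 3) =
      ∑ g ∈ G.filter (fun g => ¬ (I.vars g 2 ∈ privs I N ∨ I.vars g 3 ∈ privs I N)), x (I.vars g 2) * x (I.vars g 3)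
      + ∑ v ∈ privs I N, x v * ∑ g ∈ G, ((if I.vars g 2 = v then x (I.vars g 3) else 0) + (if I.vars g 3 = v then x (I.vars g 2) else 0)) := by
    have hswap : ∑ v ∈ privs I N, x v * ∑ g ∈ G, ((if I.vars g 2 = v then x (I.vars g 3) else 0) + (if I.vars g 3 = v then x (I.vars g 2) else 0))
        = ∑ g ∈ G, ((if I.vars g 2 ∈ privs I N then x (I.vars g 2) * x (I.vars g 3) else 0)
            + (if I.vars g 3 ∈ privs I N then x (I.vars g 2) * x (I.vars g 3) else 0)) := by
      simp_rw [mul_sum]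
      rw [sum_comm]
      refine sum_congr rfl fun g _ => ?_
      rw [sum_congr rfl fun v _ => mul_add (x v) _ _, sum_add_distrib]
      congr 1
      · simp only [mul_ite, mul_zero, sum_ite_eq]
      · simp only [mul_ite, mul_zero, sum_ite_eq]
        split_ifs
        · exact mul_comm _ _
        · rfl
    rw [hswap, ← sum_filter_add_sum_filter_not G (fun g => ¬ (I.vars g 2 ∈ privs I N ∨ I.vars g 3 ∈ privs I N))]
    congr 1
    rw [sum_filter]
    refine sum_congr rfl fun g hg => ?_
    by_cases h2 : I.vars g 2 ∈ privs I N <;> by_cases h3 : I.vars g 3 ∈ privs I N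
    · exact absurd ⟨h2, h3⟩ (hcross g hg)
    · simp [h2, h3]
    · simp [h2, h3]
    · simp [h2, h3]
  -- reassemble over the chords
  rw [bit_gval, hC, hG, sum_privs I hI hN hch, sum_privs I hI hN hch]
  unfold free coef
  simp only [mul_add, mul_ite, mul_one, mul_zero, sum_add_distrib]
  ring

end Summit.PneNP.PneNP.Theorems.PstarChordBridgeTools
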